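import Literature.MathematicalPhysics.QuantumLattice.GermMarkovSpectralCriterion
import Literature.MathematicalPhysics.QuantumFieldTheory.GaussianFieldOfCovariance
import Mathlib.RingTheory.MvPolynomial.Basic
import Mathlib.Topology.Algebra.MvPolynomial
import Mathlib.MeasureTheory.Measure.OpenPos
import Mathlib.MeasureTheory.Measure.Haar.OfBasis
import Mathlib.Analysis.InnerProductSpace.PiL2
import Mathlib.Analysis.SpecialFunctions.JapaneseBracket
import HarnessLib

/-!
# Counterexample material for `InvSpectralDensityPolynomialOfGermMarkov` (Erratum)

THEOREM-ONLY companion to the Erratum in `GermMarkovSpectralCriterion.lean`: the germ-form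
statement `InvSpectralDensityPolynomialOfGermMarkov` is false, witnessed by the spectral density
`φ(ξ) = 1 + ‖ξ‖²` on `ℝᵈ`, `d ≥ 1` (white noise plus an independent gradient of white noise).
This file collects the machine-checked parts of that counterexample; the remaining parts (the
spectral form of the covariance, by Plancherel, and the germ σ-algebras of the law:
`germSigma (closure B) ⫫ germSigma Bᶜ` and `germSigma (∂B)` trivial) are documented in the
Erratum and not yet formalised.

* `exists_counterexampleLaw_one` — **the law exists** (`d = 1`): by the tree's Minlos theorem
  (`exists_gaussianField_of_bilinForm`, Glimm–Jaffe §6.2) there is a centred Gaussian probability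
  law on `𝒮'(ℝ¹)` with the LOCAL two-point function
  `E[ω(u)ω(v)] = ∫ u v + (4π²)⁻¹ ∫ (∂u)(∂v)` (`∂` the derivative along the basis vector), i.e.
  white noise plus `(2π)⁻¹×` an independent derivative of white noise — spectral density
  `1 + ‖ξ‖²` in Mathlib's Fourier convention.

* `inv_one_add_norm_sq_ne_eval` — **the conclusion fails for `φ = 1 + ‖ξ‖²`**: there is no real
  polynomial `P` in `d ≥ 1` variables with `(1 + ‖ξ‖²)⁻¹ = P(ξ)` for a.e. `ξ` (both sides are
  continuous, so they would agree everywhere; along a coordinate axis `P` restricts to a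
  one-variable polynomial `q` with `q(t) (1 + t²) = 1`, impossible by degrees).
* `counterexampleDensity_hypotheses` — the analytic hypotheses of the fact hold for
  `φ = 1 + ‖ξ‖²`: measurable, nonnegative, positive, even, Rozanov's (2.4) and (2.19) (both with
  `m = d + 2`: the integrands are `(1 + ‖ξ‖²)^{-(d+1)}` and `(1 + ‖ξ‖²)^{-(d+3)}`).

[folklore]
-/

noncomputable section

open MeasureTheory
open scoped SchwartzMap

namespace Literature.MathematicalPhysics.QuantumLattice

/-! ### No polynomial equals `(1 + ‖ξ‖²)⁻¹` -/

/-- A one-variable real polynomial cannot satisfy `q(t) · (1 + t²) = 1` for all `t`. [folklore] -/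
theorem not_forall_eval_mul_one_add_sq_eq_one (q : Polynomial ℝ) :
    ¬ ∀ t : ℝ, q.eval t * (1 + t ^ 2) = 1 := by
  intro h
  have hq : q * (1 + Polynomial.X ^ 2) = 1 := by
    refine Polynomial.funext fun t => ?_
    simp [h t]
  have hX : (1 + Polynomial.X ^ 2 : Polynomial ℝ).natDegree = 2 := by
    rw [add_comm]
    exact Polynomial.natDegree_X_pow_add_C
  have hq0 : q ≠ 0 := by
    rintro rfl
    simp at hq
  have hX0 : (1 + Polynomial.X ^ 2 : Polynomial ℝ) ≠ 0 := by
    intro h0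
    rw [h0, Polynomial.natDegree_zero] at hX
    exact two_ne_zero hX.symm
  have hdeg := congrArg Polynomial.natDegree hq
  rw [Polynomial.natDegree_mul hq0 hX0, hX, Polynomial.natDegree_one] at hdeg
  omega

/-- Restriction of a real polynomial in `d` variables to the line `t ↦ t • e` is a one-variable
polynomial. [folklore] -/
theorem exists_polynomial_eval_smul {d : ℕ} (P : MvPolynomial (Fin d) ℝ) (e : Fin d → ℝ) :
    ∃ q : Polynomial ℝ, ∀ t : ℝ, q.eval t = MvPolynomial.eval (fun i => t * e i) P := by
  refine ⟨MvPolynomial.aeval (fun i => Polynomial.C (e i) * Polynomial.X) P, fun t => ?_⟩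
  rw [MvPolynomial.aeval_def, MvPolynomial.eval₂_eq', MvPolynomial.eval_eq', Polynomial.eval_finsetSum]
  refine Finset.sum_congr rfl fun m _ => ?_
  rw [Polynomial.eval_mul, Polynomial.eval_prod, Polynomial.algebraMap_apply, Polynomial.eval_C]
  simp only [Algebra.algebraMap_self, RingHom.id_apply, Polynomial.eval_pow, Polynomial.eval_mul,
    Polynomial.eval_C, Polynomial.eval_X, mul_comm (e _) t]

/-- **The conclusion of `InvSpectralDensityPolynomialOfGermMarkov` fails for `φ = 1 + ‖ξ‖²`
(`d ≥ 1`)**: `(1 + ‖ξ‖²)⁻¹` is not a.e. equal to a polynomial. [folklore] -/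
theorem inv_one_add_norm_sq_ne_eval {d : ℕ} (hd : 0 < d) (P : MvPolynomial (Fin d) ℝ) :
    ¬ (∀ᵐ ξ ∂(volume : Measure (EuclideanSpace ℝ (Fin d))),
      (1 + ‖ξ‖ ^ 2)⁻¹ = MvPolynomial.eval (fun i => ξ i) P) := by
  intro hae
  -- both sides are continuous, hence equal everywhere
  have hcont₁ : Continuous fun ξ : EuclideanSpace ℝ (Fin d) => (1 + ‖ξ‖ ^ 2)⁻¹ :=
    Continuous.inv₀ (by fun_prop) fun ξ => by positivity
  have hcont₂ : Continuous fun ξ : EuclideanSpace ℝ (Fin d) =>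
      MvPolynomial.eval (fun i => ξ i) P :=
    (MvPolynomial.continuous_eval P).comp (by fun_prop)
  have heq := (Continuous.ae_eq_iff_eq volume hcont₁ hcont₂).1 hae
  -- restrict to the first coordinate axis
  set e : Fin d → ℝ := fun i => if i = ⟨0, hd⟩ then 1 else 0 with he
  obtain ⟨q, hq⟩ := exists_polynomial_eval_smul P e
  refine not_forall_eval_mul_one_add_sq_eq_one q fun t => ?_
  -- the point `t • e` as an element of `EuclideanSpace ℝ (Fin d)` has norm `|t|`
  set ξ : EuclideanSpace ℝ (Fin d) := (WithLp.toLp 2 fun i => t * e i) with hξ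
  have hξi : ∀ i, ξ i = t * e i := fun i => rfl
  have hnorm : ‖ξ‖ ^ 2 = t ^ 2 := by
    rw [EuclideanSpace.norm_sq_eq]
    simp only [hξi, he, mul_ite, mul_one, mul_zero, Real.norm_eq_abs]
    have habs : ∀ x : Fin d, |(if x = (⟨0, hd⟩ : Fin d) then t else 0)| ^ 2 =
        if x = (⟨0, hd⟩ : Fin d) then t ^ 2 else 0 := fun x => by
      split_ifs <;> simp [sq_abs]
    simp only [habs, Finset.sum_ite_eq', Finset.mem_univ, if_true]
  have h1 := congrFun heq ξ
  simp only at h1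
  rw [hnorm] at h1
  rw [hq t, show (fun i => t * e i) = fun i => ξ i from funext fun i => (hξi i).symm, ← h1,
    inv_mul_cancel₀]
  positivity

/-! ### The analytic hypotheses hold for `φ = 1 + ‖ξ‖²` -/

/-- `(1 + ‖ξ‖²)^{-m} (1 + ‖ξ‖²)^{s} = (1 + ‖ξ‖²)^{-(m - s)}` is integrable on `ℝᵈ` as soon as
`2 (m - s) > d`. [folklore] -/
theorem integrable_one_add_norm_sq_rpow_mul_zpow {d : ℕ} {m : ℕ} {k : ℤ}
    (h : (d : ℝ) < 2 * ((m : ℝ) - k)) :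
    Integrable (fun ξ : EuclideanSpace ℝ (Fin d) =>
      (1 + ‖ξ‖ ^ 2) ^ (-(m : ℝ)) * (1 + ‖ξ‖ ^ 2) ^ k) := by
  have hint := integrable_rpow_neg_one_add_norm_sq (E := EuclideanSpace ℝ (Fin d)) (μ := volume)
    (r := 2 * ((m : ℝ) - k)) (by rwa [finrank_euclideanSpace_fin])
  refine hint.congr (Filter.Eventually.of_forall fun ξ => ?_)
  have hpos : 0 < 1 + ‖ξ‖ ^ 2 := by positivity
  simp only
  rw [← Real.rpow_intCast, ← Real.rpow_add hpos]
  congr 1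
  ring

/-- **The analytic hypotheses of `InvSpectralDensityPolynomialOfGermMarkov` hold for the
counterexample density `φ(ξ) = 1 + ‖ξ‖²`** on `ℝᵈ`: measurability, `0 ≤ φ`, `0 < φ` (a.e.),
evenness, (2.4) and (2.19), the latter two with `m = d + 2`. [folklore] -/
theorem counterexampleDensity_hypotheses (d : ℕ) :
    Measurable (fun ξ : EuclideanSpace ℝ (Fin d) => 1 + ‖ξ‖ ^ 2) ∧
    (∀ ξ : EuclideanSpace ℝ (Fin d), 0 ≤ 1 + ‖ξ‖ ^ 2) ∧
    (∀ᵐ ξ ∂(volume : Measure (EuclideanSpace ℝ (Fin d))), 0 < 1 + ‖ξ‖ ^ 2) ∧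
    (∀ ξ : EuclideanSpace ℝ (Fin d), 1 + ‖-ξ‖ ^ 2 = 1 + ‖ξ‖ ^ 2) ∧
    (∃ m : ℕ, Integrable (fun ξ : EuclideanSpace ℝ (Fin d) =>
      (1 + ‖ξ‖ ^ 2) ^ (-(m : ℝ)) * (1 + ‖ξ‖ ^ 2))) ∧
    (∃ m : ℕ, Integrable (fun ξ : EuclideanSpace ℝ (Fin d) =>
      (1 + ‖ξ‖ ^ 2) ^ (-(m : ℝ)) * (1 + ‖ξ‖ ^ 2)⁻¹)) := by
  refine ⟨by fun_prop, fun ξ => by positivity, Filter.Eventually.of_forall fun ξ => by positivity,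
    fun ξ => by rw [norm_neg], ⟨d + 2, ?_⟩, ⟨d + 2, ?_⟩⟩
  · have h := integrable_one_add_norm_sq_rpow_mul_zpow (d := d) (m := d + 2) (k := 1)
      (by push_cast; linarith)
    simpa using h
  · have h := integrable_one_add_norm_sq_rpow_mul_zpow (d := d) (m := d + 2) (k := -1)
      (by push_cast; linarith)
    simpa [zpow_neg, zpow_one] using h

/-! ### The counterexample law exists (Minlos) -/

section Law

open Literature.MathematicalPhysics.QuantumFieldTheory
open scoped LineDeriv RealInnerProductSpace

/-- The line `ℝ¹` as a Euclidean space. [folklore] -/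
private abbrev E1 : Type := EuclideanSpace ℝ (Fin 1)

/-- The basis direction of `ℝ¹`. [folklore] -/
private abbrev e0 : E1 := EuclideanSpace.single (0 : Fin 1) (1 : ℝ)

/-- The derivative `∂_{e₀}` as a linear map on real Schwartz functions of `ℝ¹`. [folklore] -/
private abbrev D1 : 𝓢(E1, ℝ) →ₗ[ℝ] 𝓢(E1, ℝ) :=
  (LineDeriv.lineDerivOpCLM ℝ 𝓢(E1, ℝ) e0 : 𝓢(E1, ℝ) →L[ℝ] 𝓢(E1, ℝ))

/-- The embedding of real Schwartz functions of `ℝ¹` into `L²(ℝ¹)` as a linear map. [folklore] -/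
private abbrev T1 : 𝓢(E1, ℝ) →ₗ[ℝ] Lp ℝ 2 (volume : Measure E1) :=
  (SchwartzMap.toLpCLM ℝ ℝ 2 (volume : Measure E1) : 𝓢(E1, ℝ) →L[ℝ] Lp ℝ 2 (volume : Measure E1))

/-- The `H¹`-type covariance form `B(u, v) = ⟪u, v⟫_{L²} + (4π²)⁻¹ ⟪∂u, ∂v⟫_{L²}` on real Schwartz
functions of `ℝ¹`, as a bilinear form (built from `innerₗ` on `L²`). [folklore] -/
def counterexampleForm : LinearMap.BilinForm ℝ 𝓢(E1, ℝ) :=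
  LinearMap.BilinForm.comp (innerₗ (Lp ℝ 2 (volume : Measure E1))) T1 T1 +
    (4 * Real.pi ^ 2)⁻¹ • LinearMap.BilinForm.comp (innerₗ (Lp ℝ 2 (volume : Measure E1)))
      (T1.comp D1) (T1.comp D1)

/-- Unfolding `counterexampleForm` into inner products in `L²`. [folklore] -/
theorem counterexampleForm_apply (u v : 𝓢(E1, ℝ)) :
    counterexampleForm u v = ⟪u.toLp 2 (volume : Measure E1), v.toLp 2 volume⟫ +
      (4 * Real.pi ^ 2)⁻¹ * ⟪(∂_{e0} u : 𝓢(E1, ℝ)).toLp 2 (volume : Measure E1),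
        (∂_{e0} v : 𝓢(E1, ℝ)).toLp 2 volume⟫ := by
  simp only [counterexampleForm, LinearMap.add_apply, LinearMap.smul_apply,
    LinearMap.BilinForm.comp_apply, LinearMap.coe_comp, Function.comp_apply,
    ContinuousLinearMap.coe_coe, SchwartzMap.toLpCLM_apply, LineDeriv.lineDerivOpCLM_apply,
    innerₗ_apply_apply, smul_eq_mul]

/-- The `L²` inner product of two real Schwartz functions is the integral of their product.
[folklore] -/
theorem inner_toLp_schwartz (u v : 𝓢(E1, ℝ)) :
    ⟪u.toLp 2 (volume : Measure E1), v.toLp 2 volume⟫ = ∫ x, u x * v x := by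
  rw [L2.inner_def]
  refine integral_congr_ae ?_
  filter_upwards [SchwartzMap.coeFn_toLp u 2 (volume : Measure E1),
    SchwartzMap.coeFn_toLp v 2 (volume : Measure E1)] with x h1 h2
  rw [h1, h2]
  simp [mul_comm]

/-- `counterexampleForm` is symmetric. [folklore] -/
theorem counterexampleForm_comm (u v : 𝓢(E1, ℝ)) :
    counterexampleForm u v = counterexampleForm v u := by
  rw [counterexampleForm_apply, counterexampleForm_apply, real_inner_comm (u.toLp 2 _),
    real_inner_comm ((∂_{e0} u : 𝓢(E1, ℝ)).toLp 2 _)]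

/-- `counterexampleForm` has a nonnegative diagonal. [folklore] -/
theorem counterexampleForm_self_nonneg (u : 𝓢(E1, ℝ)) : 0 ≤ counterexampleForm u u := by
  rw [counterexampleForm_apply]
  exact add_nonneg real_inner_self_nonneg
    (mul_nonneg (by positivity) real_inner_self_nonneg)

/-- The diagonal of `counterexampleForm` is continuous on `𝓢(ℝ¹, ℝ)` (it factors through the
continuous embeddings into `L²`). [folklore] -/
theorem continuous_counterexampleForm_self :
    Continuous fun u : 𝓢(E1, ℝ) => counterexampleForm u u := by
  have h1 : Continuous fun u : 𝓢(E1, ℝ) =>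
      ⟪SchwartzMap.toLpCLM ℝ ℝ 2 (volume : Measure E1) u,
        SchwartzMap.toLpCLM ℝ ℝ 2 (volume : Measure E1) u⟫ :=
    (SchwartzMap.toLpCLM ℝ ℝ 2 (volume : Measure E1)).continuous.inner
      (SchwartzMap.toLpCLM ℝ ℝ 2 (volume : Measure E1)).continuous
  have h2 : Continuous fun u : 𝓢(E1, ℝ) =>
      ⟪SchwartzMap.toLpCLM ℝ ℝ 2 (volume : Measure E1)
          (LineDeriv.lineDerivOpCLM ℝ 𝓢(E1, ℝ) e0 u),
        SchwartzMap.toLpCLM ℝ ℝ 2 (volume : Measure E1)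
          (LineDeriv.lineDerivOpCLM ℝ 𝓢(E1, ℝ) e0 u)⟫ :=
    ((SchwartzMap.toLpCLM ℝ ℝ 2 (volume : Measure E1)).continuous.comp
      (LineDeriv.lineDerivOpCLM ℝ 𝓢(E1, ℝ) e0).continuous).inner
      ((SchwartzMap.toLpCLM ℝ ℝ 2 (volume : Measure E1)).continuous.comp
        (LineDeriv.lineDerivOpCLM ℝ 𝓢(E1, ℝ) e0).continuous)
  have h3 := h1.add (continuous_const.mul h2 : Continuous fun u : 𝓢(E1, ℝ) =>
    (4 * Real.pi ^ 2)⁻¹ * _)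
  refine h3.congr fun u => ?_
  simp only [Pi.add_apply, Pi.mul_apply, SchwartzMap.toLpCLM_apply, LineDeriv.lineDerivOpCLM_apply,
    counterexampleForm_apply]

/-- **The counterexample law exists (`d = 1`).**  There is a centred Gaussian probability law on
`𝒮'(ℝ¹)` whose two-point function is the LOCAL form
`E[ω(u)ω(v)] = ∫ u v + (4π²)⁻¹ ∫ (∂u)(∂v)` — white noise plus `(2π)⁻¹×` an independent derivative
of white noise, the field with spectral density `1 + ‖ξ‖²` of the Erratum of
`GermMarkovSpectralCriterion.lean`.  Existence by the tree's Minlos theorem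
(`exists_gaussianField_of_bilinForm`, Glimm–Jaffe §6.2 (6.2.1)–(6.2.2)); the two-point function
from the generating functional by `integral_sq_eval_of_genFunctional_eq` and polarisation.
[cite: GlimmJaffeQP1987, §6.2 (6.2.1)–(6.2.2)] -/
theorem exists_counterexampleLaw_one :
    ∃ μ : Measure (FieldConfig E1), IsProbabilityMeasure μ ∧ IsGaussianField μ ∧
      ∀ u v : 𝓢(E1, ℝ), twoPoint μ u v =
        (∫ x, u x * v x) + (4 * Real.pi ^ 2)⁻¹ *
          ∫ x, (∂_{e0} u : 𝓢(E1, ℝ)) x * (∂_{e0} v : 𝓢(E1, ℝ)) x := by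
  obtain ⟨μ, hG, hgen⟩ := exists_gaussianField_of_bilinForm counterexampleForm
    counterexampleForm_comm counterexampleForm_self_nonneg continuous_counterexampleForm_self
  haveI : ProbabilityTheory.IsGaussian μ := hG.1
  refine ⟨μ, inferInstance, hG, fun u v => ?_⟩
  have hsq : ∀ f : 𝓢(E1, ℝ), ∫ ω, (ω f) ^ 2 ∂μ = counterexampleForm f f :=
    integral_sq_eval_of_genFunctional_eq hG _ hgen
  rw [hG.twoPoint_eq_polar u v, hsq, hsq]
  -- polarisation of the symmetric bilinear form
  have hpol : counterexampleForm (u + v) (u + v) - counterexampleForm (u - v) (u - v) =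
      4 * counterexampleForm u v := by
    simp only [map_add, map_sub, LinearMap.add_apply, LinearMap.sub_apply,
      counterexampleForm_comm v u]
    ring
  rw [hpol, counterexampleForm_apply, inner_toLp_schwartz, inner_toLp_schwartz]
  ring

end Law

end Literature.MathematicalPhysics.QuantumLattice
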